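import Summits.AtomisticToContinuum.Crystallization.Theorems.PhononSlackCertificatesPeriodicGivenLayeredRecurrence1
import Summits.AtomisticToContinuum.Crystallization.Theorems.PricedLinkCensusStackingHingeWords

/-!
# `PeriodicGivenLayered` (stmt-AtomisticToContinuum-11779), line `Sketch`: stub `stub_recurrence`
# (a uniformly recurrent layered set in the hull)

Stub 2 of the line skeleton of the crux `PhononSlackCertificates.PeriodicGivenLayered`
(= `HullMinimality.PeriodicGivenLayered`). If a layered set `A(S(a, s, z))` (rigid motion `A`, Hägg word
`s`, heights `z` with increments in the box `[39a/50, 17a/20]`) is in the hull of a sequence of finite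
configurations `x` (two-way `ε`-matched on every ball by translates of `x N`, frequently in `N`), then so is
a layered set `A(S(a, s', z'))` with the same `a` and `A`, heights in the box, whose data `(s', Δz')` are
UNIFORMLY RECURRENT (every finite block that occurs once occurs, up to `η` in the increments, within a
bounded gap of every position). No hypothesis on `x`.

Proof (symbolic dynamics, [folklore]): on the data space `(ℤ → ℤ) × (ℤ → ℝ)` (product topology) the
renormalised shifts `σ_t (s, z) = (s(· + t), z(· + t) − z(t))` are continuous and satisfy
`σ_{t+u} = σ_t ∘ σ_u`; the orbit of `(s, z)` lies in the compact set `{±1}^ℤ × ∏_m [−17a|m|/20, 17a|m|/20]`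
(`rec_growth`), so its closure is compact and, by `rec_exists_uniformlyRecurrent` (Zorn: a minimal closed
invariant subset), contains a point `y = (s', z')` with uniform return times to every basic open set it
visits — this is the recurrence clause. Closed conditions pass to the limit: `s'` is `±1`-valued, `z' 0 = 0`,
increments in the box. Finally `A(S(a, s', z'))` is in the hull: `y` is approximated on every window
`[−M, M]` by some `σ_t (s, z)`, whose layered set is the translate of `A(S(a, s, z))` by
`−A(L_s(t) w + z(t) e₃)` (`rec_layered_reindex`, `rec_hull_translate`), and agreement of the data on
`[−M, M]` with `39a M/50 ≥ R` makes the two layered sets `δ`-close on the ball of radius `R` (points of norm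
`≤ R` come from layers `|m| ≤ M`, labels only depend on the word on `[−M, M]`); the hull is closed under such
local limits (`rec_hull_of_forall_approx`).
-/

noncomputable section

namespace Summit.AtomisticToContinuum.Crystallization.Theorems.LayeredHull

open scoped BigOperators
open Filter Literature.MathematicalPhysics.StatisticalMechanics

/-! ## Re-indexing the layers is a translation -/

/-- Increments of the re-indexed, renormalised heights `z(· + t) − z(t)` stay in the box. [folklore] -/
theorem rec_shift_box {z : ℤ → ℝ} {lo hi : ℝ}
    (hz : ∀ m : ℤ, lo ≤ z (m + 1) - z m ∧ z (m + 1) - z m ≤ hi) (t m : ℤ) :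
    lo ≤ (z (m + 1 + t) - z t) - (z (m + t) - z t) ∧
      (z (m + 1 + t) - z t) - (z (m + t) - z t) ≤ hi := by
  have := hz (m + t)
  rw [show m + t + 1 = m + 1 + t by ring] at this
  constructor <;> linarith [this.1, this.2]

/-- **Re-indexing is a translation.** The point `(m, i, j)` of the layered set with re-indexed data
`(s(· + t), z(· + t) − z(t))`, translated by `A (L_s(t) w + z(t) e₃)`, is the point `(m + t, i, j)` of the
layered set with data `(s, z)` (`L_{s(·+t)}(m) = L_s(m + t) − L_s(t)`, `haggLabel_shift`). [folklore] -/
theorem rec_layered_reindex (A : EuclideanSpace ℝ (Fin 3) →ₗᵢ[ℝ] EuclideanSpace ℝ (Fin 3)) (a : ℝ) (s : ℤ → ℤ)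
    (z : ℤ → ℝ) (t m i j : ℤ) :
    A (((i : ℝ) • triangularVec₁ a) + ((j : ℝ) • triangularVec₂ a) +
        ((haggLabel (fun k => s (k + t)) m : ℝ) • barlowOffset a) +
        ((z (m + t) - z t) • layerNormal 1)) +
      A (((haggLabel s t : ℝ) • barlowOffset a) + (z t • layerNormal 1)) =
    A (((i : ℝ) • triangularVec₁ a) + ((j : ℝ) • triangularVec₂ a) +
        ((haggLabel s (m + t) : ℝ) • barlowOffset a) + (z (m + t) • layerNormal 1)) := by
  rw [← A.map_add, haggLabel_shift]
  congr 1
  push_cast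
  module

/-! ## Pointwise limits of re-indexed data stay in the hull -/

/-- **Limits of re-indexed data give hull members.** Let `A(S(a, s, z))` be in the hull of `x` (heights
with increments in `[lo, hi]`, `0 < lo`), and let `(s', z')` (`z' 0 = 0`, increments in `[lo, hi]`) be
approximated on every window `[−M, M]`, to every precision `δ`, by re-indexed renormalised data
`(s(· + t), z(· + t) − z(t))`. Then `A(S(a, s', z'))` is in the hull of `x`. [folklore] -/
theorem rec_hull_of_limit (x : (N : ℕ) → (Fin N → EuclideanSpace ℝ (Fin 3))) {lo hi : ℝ} (hlo : 0 < lo)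
    (A : EuclideanSpace ℝ (Fin 3) →ₗᵢ[ℝ] EuclideanSpace ℝ (Fin 3)) (a : ℝ) (s : ℤ → ℤ) (z : ℤ → ℝ)
    (hz : ∀ m : ℤ, lo ≤ z (m + 1) - z m ∧ z (m + 1) - z m ≤ hi)
    (hH : ∀ R ε : ℝ, 0 < ε → ∃ᶠ N in atTop, ∃ t : EuclideanSpace ℝ (Fin 3),
      (∀ p ∈ {p : EuclideanSpace ℝ (Fin 3) | ∃ m i j : ℤ, p = A (((i : ℝ) • triangularVec₁ a) +
          ((j : ℝ) • triangularVec₂ a) + ((haggLabel s m : ℝ) • barlowOffset a) + (z m • layerNormal 1))},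
        ‖p‖ ≤ R → ∃ i : Fin N, dist (x N i + t) p ≤ ε) ∧
      (∀ i : Fin N, ‖x N i + t‖ ≤ R →
        ∃ p ∈ {p : EuclideanSpace ℝ (Fin 3) | ∃ m i j : ℤ, p = A (((i : ℝ) • triangularVec₁ a) +
          ((j : ℝ) • triangularVec₂ a) + ((haggLabel s m : ℝ) • barlowOffset a) + (z m • layerNormal 1))},
        dist (x N i + t) p ≤ ε))
    (s' : ℤ → ℤ) (z' : ℤ → ℝ) (hz'0 : z' 0 = 0)
    (hz' : ∀ m : ℤ, lo ≤ z' (m + 1) - z' m ∧ z' (m + 1) - z' m ≤ hi)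
    (happrox : ∀ (M : ℕ) (δ : ℝ), 0 < δ → ∃ t : ℤ,
      (∀ k : ℤ, -(M : ℤ) ≤ k → k ≤ M → s (k + t) = s' k) ∧
      (∀ k : ℤ, -(M : ℤ) ≤ k → k ≤ M → |z (k + t) - z t - z' k| ≤ δ)) :
    ∀ R ε : ℝ, 0 < ε → ∃ᶠ N in atTop, ∃ t : EuclideanSpace ℝ (Fin 3),
      (∀ p ∈ {p : EuclideanSpace ℝ (Fin 3) | ∃ m i j : ℤ, p = A (((i : ℝ) • triangularVec₁ a) +
          ((j : ℝ) • triangularVec₂ a) + ((haggLabel s' m : ℝ) • barlowOffset a) + (z' m • layerNormal 1))},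
        ‖p‖ ≤ R → ∃ i : Fin N, dist (x N i + t) p ≤ ε) ∧
      (∀ i : Fin N, ‖x N i + t‖ ≤ R →
        ∃ p ∈ {p : EuclideanSpace ℝ (Fin 3) | ∃ m i j : ℤ, p = A (((i : ℝ) • triangularVec₁ a) +
          ((j : ℝ) • triangularVec₂ a) + ((haggLabel s' m : ℝ) • barlowOffset a) + (z' m • layerNormal 1))},
        dist (x N i + t) p ≤ ε) := by
  refine rec_hull_of_forall_approx x fun R δ hδ => ?_
  obtain ⟨t, hts, htz⟩ := happrox ⌈R / lo⌉₊ δ hδ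
  -- points of norm `≤ R` come from layers `|m| ≤ ⌈R / lo⌉₊`
  have hlayer : ∀ w : ℤ → ℝ, w 0 = 0 → (∀ m : ℤ, lo ≤ w (m + 1) - w m ∧ w (m + 1) - w m ≤ hi) →
      ∀ m : ℤ, |w m| ≤ R → -((⌈R / lo⌉₊ : ℕ) : ℤ) ≤ m ∧ m ≤ ((⌈R / lo⌉₊ : ℕ) : ℤ) := by
    intro w hw0 hw m hm
    have h1 := (rec_growth hw0 hlo.le hw m).1
    have h2 : |(m : ℝ)| ≤ R / lo := by
      rw [le_div_iff₀ hlo, mul_comm]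
      exact h1.trans hm
    have h3 : |(m : ℝ)| ≤ ((⌈R / lo⌉₊ : ℕ) : ℝ) := h2.trans (Nat.le_ceil _)
    have h4 : |m| ≤ ((⌈R / lo⌉₊ : ℕ) : ℤ) := by exact_mod_cast h3
    exact abs_le.1 h4
  have hlabel : ∀ m : ℤ, -((⌈R / lo⌉₊ : ℕ) : ℤ) ≤ m → m ≤ ((⌈R / lo⌉₊ : ℕ) : ℤ) →
      haggLabel s' m = haggLabel (fun k => s (k + t)) m := fun m hm1 hm2 =>
    haggLabel_congr (fun k hk1 hk2 => (hts k hk1 hk2).symm) hm1 hm2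
  refine ⟨{p : EuclideanSpace ℝ (Fin 3) | ∃ m i j : ℤ, p = A (((i : ℝ) • triangularVec₁ a) +
      ((j : ℝ) • triangularVec₂ a) + ((haggLabel (fun k => s (k + t)) m : ℝ) • barlowOffset a) +
      ((z (m + t) - z t) • layerNormal 1))}, ?_, ?_, ?_⟩
  · -- the re-indexed layered set is a translate of `A(S(a, s, z))`, hence in the hull
    refine rec_hull_translate x (A (((haggLabel s t : ℝ) • barlowOffset a) + (z t • layerNormal 1))) hH
      ?_ ?_
    · rintro _ ⟨m, i, j, rfl⟩
      exact ⟨m + t, i, j, rec_layered_reindex A a s z t m i j⟩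
    · rintro _ ⟨m, i, j, rfl⟩
      refine ⟨m - t, i, j, ?_⟩
      rw [sub_eq_iff_eq_add, rec_layered_reindex, sub_add_cancel]
  · -- every point of `A(S(a, s', z'))` of norm `≤ R` is `δ`-close to the re-indexed set
    rintro _ ⟨m, i, j, rfl⟩ hpR
    have hm := hlayer z' hz'0 hz' m ((rec_abs_height_le_norm A a _ _ _ _).trans hpR)
    refine ⟨_, ⟨m, i, j, rfl⟩, ?_⟩
    rw [hlabel m hm.1 hm.2, rec_dist_layered_eq, abs_sub_comm]
    have := htz m hm.1 hm.2
    rwa [show z (m + t) - z t - z' m = (z (m + t) - z t) - z' m by ring] at this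
  · -- and conversely
    rintro _ ⟨m, i, j, rfl⟩ hqR
    have hm := hlayer (fun k => z (k + t) - z t) (by simp) (rec_shift_box hz t) m
      ((rec_abs_height_le_norm A a _ _ _ _).trans hqR)
    refine ⟨_, ⟨m, i, j, rfl⟩, ?_⟩
    rw [hlabel m hm.1 hm.2, rec_dist_layered_eq]
    exact htz m hm.1 hm.2

/-! ## The stub -/

/-- **Stub 2 (recurrence).** If a layered set `A(S(a,s,z))` (Hägg word `s`, heights `z` in the box) is in the
hull of `x` (matched at every scale, frequently in `N`), then so is a layered set `A(S(a,s',z'))` with the same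
`a`, `A`, heights in the box, whose data are UNIFORMLY RECURRENT: every finite pattern of `(s', Δz')` that
occurs once occurs, up to `η` in the increments, within a bounded gap of every position. (Minimal subset of the
shift-orbit closure of `(s, Δz)` in the compact product space; closedness of the hull under translations and
local limits.) No hypothesis on `x`. [folklore] -/
theorem stub_recurrence (x : (N : ℕ) → (Fin N → EuclideanSpace ℝ (Fin 3))) (a : ℝ) (ha : 47 / 50 ≤ a)
    (ha1 : a ≤ 1)
    (A : EuclideanSpace ℝ (Fin 3) →ₗᵢ[ℝ] EuclideanSpace ℝ (Fin 3)) (s : ℤ → ℤ) (z : ℤ → ℝ) (hs : IsHaggSeq s)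
    (hz : ∀ m : ℤ, 39 / 50 * a ≤ z (m + 1) - z m ∧ z (m + 1) - z m ≤ 17 / 20 * a)
    (hH : let S : Set (EuclideanSpace ℝ (Fin 3)) := {p | ∃ m i j : ℤ, p = A (((i : ℝ) • triangularVec₁ a) +
        ((j : ℝ) • triangularVec₂ a) + ((haggLabel s m : ℝ) • barlowOffset a) + (z m • layerNormal 1))};
      ∀ R ε : ℝ, 0 < ε → ∃ᶠ N in atTop, ∃ t : EuclideanSpace ℝ (Fin 3),
        (∀ p ∈ S, ‖p‖ ≤ R → ∃ i : Fin N, dist (x N i + t) p ≤ ε) ∧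
        (∀ i : Fin N, ‖x N i + t‖ ≤ R → ∃ p ∈ S, dist (x N i + t) p ≤ ε)) :
    ∃ (s' : ℤ → ℤ) (z' : ℤ → ℝ), IsHaggSeq s' ∧
      (∀ m : ℤ, 39 / 50 * a ≤ z' (m + 1) - z' m ∧ z' (m + 1) - z' m ≤ 17 / 20 * a) ∧
      (∀ (n : ℕ) (η : ℝ), 0 < η → ∀ m₀ : ℤ, ∃ G : ℕ, ∀ m : ℤ, ∃ g : ℤ, 0 ≤ g ∧ g ≤ G ∧
        ∀ k : ℕ, k < n → s' (m + g + k) = s' (m₀ + k) ∧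
          |(z' (m + g + k + 1) - z' (m + g + k)) - (z' (m₀ + k + 1) - z' (m₀ + k))| ≤ η) ∧
      let S : Set (EuclideanSpace ℝ (Fin 3)) := {p | ∃ m i j : ℤ, p = A (((i : ℝ) • triangularVec₁ a) +
        ((j : ℝ) • triangularVec₂ a) + ((haggLabel s' m : ℝ) • barlowOffset a) + (z' m • layerNormal 1))};
      ∀ R ε : ℝ, 0 < ε → ∃ᶠ N in atTop, ∃ t : EuclideanSpace ℝ (Fin 3),
        (∀ p ∈ S, ‖p‖ ≤ R → ∃ i : Fin N, dist (x N i + t) p ≤ ε) ∧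
        (∀ i : Fin N, ‖x N i + t‖ ≤ R → ∃ p ∈ S, dist (x N i + t) p ≤ ε) := by
  have _ha1 : a ≤ 1 := ha1 -- part of the registered signature, not needed by the proof
  set lo : ℝ := 39 / 50 * a with hlo_def
  set hi : ℝ := 17 / 20 * a with hhi_def
  have hlo : 0 < lo := by rw [hlo_def]; linarith
  -- the renormalised shift on the data space `(ℤ → ℤ) × (ℤ → ℝ)`
  obtain ⟨σ, hσ⟩ : ∃ σ : ℤ → (ℤ → ℤ) × (ℤ → ℝ) → (ℤ → ℤ) × (ℤ → ℝ),
      ∀ t ω, σ t ω = (fun k => ω.1 (k + t), fun k => ω.2 (k + t) - ω.2 t) := ⟨_, fun _ _ => rfl⟩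
  have hcont : ∀ t, Continuous (σ t) := by
    intro t
    rw [show σ t = fun ω => (fun k => ω.1 (k + t), fun k => ω.2 (k + t) - ω.2 t) from funext (hσ t)]
    fun_prop
  have hadd : ∀ t u ω, σ (t + u) ω = σ t (σ u ω) := by
    intro t u ω
    simp only [hσ, Prod.mk.injEq]
    refine ⟨funext fun k => by rw [add_assoc], funext fun k => ?_⟩
    rw [← add_assoc]
    ring
  -- the orbit of `(s, z)` lies in a compact set, so its closure is compact
  have hKc : IsCompact ((Set.univ.pi fun _ : ℤ => ({1, -1} : Set ℤ)) ×ˢ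
      (Set.univ.pi fun m : ℤ => Set.Icc (-(hi * |(m : ℝ)|)) (hi * |(m : ℝ)|))) :=
    (isCompact_univ_pi fun _ => (Set.toFinite _).isCompact).prod
      (isCompact_univ_pi fun _ => isCompact_Icc)
  have hKcl : IsClosed ((Set.univ.pi fun _ : ℤ => ({1, -1} : Set ℤ)) ×ˢ
      (Set.univ.pi fun m : ℤ => Set.Icc (-(hi * |(m : ℝ)|)) (hi * |(m : ℝ)|))) :=
    (isClosed_set_pi fun _ _ => (Set.toFinite _).isClosed).prod (isClosed_set_pi fun _ _ => isClosed_Icc)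
  have horb : Set.range (fun j : ℤ => σ j (s, z)) ⊆ (Set.univ.pi fun _ : ℤ => ({1, -1} : Set ℤ)) ×ˢ
      (Set.univ.pi fun m : ℤ => Set.Icc (-(hi * |(m : ℝ)|)) (hi * |(m : ℝ)|)) := by
    rintro _ ⟨j, rfl⟩
    show σ j (s, z) ∈ _
    rw [hσ]
    refine Set.mk_mem_prod (Set.mem_univ_pi.2 fun k => ?_) (Set.mem_univ_pi.2 fun m => ?_)
    · rcases hs (k + j) with h | h <;> simp [h]
    · have hg := (rec_growth (z := fun k => z (k + j) - z j) (by simp) hlo.le (rec_shift_box hz j) m).2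
      exact Set.mem_Icc.2 (abs_le.1 hg)
  have hK : IsCompact (closure (Set.range fun j : ℤ => σ j (s, z))) :=
    hKc.of_isClosed_subset isClosed_closure (closure_minimal horb hKcl)
  -- a uniformly recurrent point of the orbit closure
  obtain ⟨y, hyO, hrec⟩ := rec_exists_uniformlyRecurrent σ hcont hadd (s, z) hK
  -- closed conditions pass to the limit
  have hCcl : IsClosed {ω : (ℤ → ℤ) × (ℤ → ℝ) | (∀ k, ω.1 k ∈ ({1, -1} : Set ℤ)) ∧ ω.2 0 = 0 ∧
      ∀ m, lo ≤ ω.2 (m + 1) - ω.2 m ∧ ω.2 (m + 1) - ω.2 m ≤ hi} := by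
    simp only [Set.setOf_and, Set.setOf_forall]
    refine (isClosed_iInter fun k => ?_).inter
      ((isClosed_eq ((continuous_apply 0).comp continuous_snd) continuous_const).inter
        (isClosed_iInter fun m =>
          (isClosed_le continuous_const (by fun_prop)).inter (isClosed_le (by fun_prop) continuous_const)))
    exact (Set.toFinite ({1, -1} : Set ℤ)).isClosed.preimage ((continuous_apply k).comp continuous_fst)
  have horbC : Set.range (fun j : ℤ => σ j (s, z)) ⊆ {ω : (ℤ → ℤ) × (ℤ → ℝ) |
      (∀ k, ω.1 k ∈ ({1, -1} : Set ℤ)) ∧ ω.2 0 = 0 ∧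
      ∀ m, lo ≤ ω.2 (m + 1) - ω.2 m ∧ ω.2 (m + 1) - ω.2 m ≤ hi} := by
    rintro _ ⟨j, rfl⟩
    show σ j (s, z) ∈ _
    rw [hσ]
    refine ⟨fun k => ?_, by simp, rec_shift_box hz j⟩
    rcases hs (k + j) with h | h <;> simp [h]
  obtain ⟨hy1, hy0, hybox⟩ := closure_minimal horbC hCcl hyO
  have hHagg : IsHaggSeq y.1 := fun k => by simpa using hy1 k
  -- uniform recurrence of `y`
  have hrec' : ∀ (n : ℕ) (η : ℝ), 0 < η → ∀ m₀ : ℤ, ∃ G : ℕ, ∀ m : ℤ, ∃ g : ℤ, 0 ≤ g ∧ g ≤ G ∧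
      ∀ k : ℕ, k < n → y.1 (m + g + k) = y.1 (m₀ + k) ∧
        |(y.2 (m + g + k + 1) - y.2 (m + g + k)) - (y.2 (m₀ + k + 1) - y.2 (m₀ + k))| ≤ η := by
    intro n η hη m₀
    set U : Set ((ℤ → ℤ) × (ℤ → ℝ)) := ⋂ k ∈ Finset.range n,
      ({ω : (ℤ → ℤ) × (ℤ → ℝ) | ω.1 k = y.1 (m₀ + k)} ∩
        {ω | |(ω.2 ((k : ℤ) + 1) - ω.2 k) - (y.2 (m₀ + k + 1) - y.2 (m₀ + k))| < η}) with hU_def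
    have hUo : IsOpen U := by
      rw [hU_def]
      refine isOpen_biInter_finset fun k _ => IsOpen.inter ?_ ?_
      · show IsOpen ((fun ω : (ℤ → ℤ) × (ℤ → ℝ) => ω.1 k) ⁻¹' {y.1 (m₀ + k)})
        exact (isOpen_discrete _).preimage (by fun_prop)
      · exact isOpen_lt (by fun_prop) continuous_const
    have hyU : σ m₀ y ∈ U := by
      rw [hU_def, hσ]
      refine Set.mem_iInter₂.2 fun k _ => ⟨?_, ?_⟩
      · exact congrArg y.1 (add_comm _ _)
      · simp only [Set.mem_setOf_eq]
        rw [show (k : ℤ) + 1 + m₀ = m₀ + k + 1 by ring, show (k : ℤ) + m₀ = m₀ + k by ring]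
        have e : y.2 (m₀ + k + 1) - y.2 m₀ - (y.2 (m₀ + k) - y.2 m₀) -
            (y.2 (m₀ + k + 1) - y.2 (m₀ + k)) = 0 := by ring
        rw [e, abs_zero]
        exact hη
    obtain ⟨G, hG⟩ := hrec U hUo m₀ hyU
    refine ⟨G, fun m => ?_⟩
    obtain ⟨g, hg0, hgG, hgU⟩ := hG m
    refine ⟨g, hg0, hgG, fun k hk => ?_⟩
    rw [hU_def, hσ] at hgU
    obtain ⟨h1, h2⟩ := Set.mem_iInter₂.1 hgU k (Finset.mem_range.2 hk)
    simp only [Set.mem_setOf_eq] at h1 h2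
    refine ⟨by rw [← h1, show m + g + (k : ℤ) = (k : ℤ) + (m + g) by ring], ?_⟩
    rw [show m + g + (k : ℤ) + 1 = (k : ℤ) + 1 + (m + g) by ring,
      show m + g + (k : ℤ) = (k : ℤ) + (m + g) by ring]
    have e : y.2 ((k : ℤ) + 1 + (m + g)) - y.2 ((k : ℤ) + (m + g)) =
        y.2 ((k : ℤ) + 1 + (m + g)) - y.2 (m + g) - (y.2 ((k : ℤ) + (m + g)) - y.2 (m + g)) := by ring
    rw [e]
    exact h2.le
  -- `y` is approximated on every window by re-indexed renormalised data
  have happrox : ∀ (M : ℕ) (δ : ℝ), 0 < δ → ∃ t : ℤ,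
      (∀ k : ℤ, -(M : ℤ) ≤ k → k ≤ M → s (k + t) = y.1 k) ∧
      (∀ k : ℤ, -(M : ℤ) ≤ k → k ≤ M → |z (k + t) - z t - y.2 k| ≤ δ) := by
    intro M δ hδ
    have hWo : IsOpen (⋂ k ∈ Finset.Icc (-(M : ℤ)) M,
        ({ω : (ℤ → ℤ) × (ℤ → ℝ) | ω.1 k = y.1 k} ∩ {ω | |ω.2 k - y.2 k| < δ})) := by
      refine isOpen_biInter_finset fun k _ => IsOpen.inter ?_ ?_
      · show IsOpen ((fun ω : (ℤ → ℤ) × (ℤ → ℝ) => ω.1 k) ⁻¹' {y.1 k})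
        exact (isOpen_discrete _).preimage (by fun_prop)
      · exact isOpen_lt (by fun_prop) continuous_const
    have hyW : y ∈ ⋂ k ∈ Finset.Icc (-(M : ℤ)) M,
        ({ω : (ℤ → ℤ) × (ℤ → ℝ) | ω.1 k = y.1 k} ∩ {ω | |ω.2 k - y.2 k| < δ}) :=
      Set.mem_iInter₂.2 fun k _ => ⟨rfl, by simp [hδ]⟩
    obtain ⟨_, hωW, ⟨t, rfl⟩⟩ := mem_closure_iff.1 hyO _ hWo hyW
    have hωW' : σ t (s, z) ∈ ⋂ k ∈ Finset.Icc (-(M : ℤ)) M,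
        ({ω : (ℤ → ℤ) × (ℤ → ℝ) | ω.1 k = y.1 k} ∩ {ω | |ω.2 k - y.2 k| < δ}) := hωW
    rw [hσ] at hωW'
    refine ⟨t, fun k hk1 hk2 => ?_, fun k hk1 hk2 => ?_⟩
    · have := (Set.mem_iInter₂.1 hωW' k (Finset.mem_Icc.2 ⟨hk1, hk2⟩)).1
      simpa using this
    · have := (Set.mem_iInter₂.1 hωW' k (Finset.mem_Icc.2 ⟨hk1, hk2⟩)).2
      simp only [Set.mem_setOf_eq] at this
      exact this.le
  -- assemble
  refine ⟨y.1, y.2, hHagg, hybox, hrec', ?_⟩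
  exact rec_hull_of_limit x hlo A a s z hz hH y.1 y.2 hy0 hybox happrox

end Summit.AtomisticToContinuum.Crystallization.Theorems.LayeredHull

end
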